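import Summits.QuantumFields.GaugeBoot.DiagonalRPTorusEvenKernels
import Summits.QuantumFields.GaugeBoot.DiagonalRPTorusTwoGaugeInvariantTable
import HarnessLib

/-!
# Diagonal RP on the even two-torus HOLDS in the gauge-invariant sector at EVERY coupling, for
EVERY compact gauge group (gauge-boot, L3 supplement — part V, capstone)

HONEST FRAMING (cell `pub-gaugeboot`, page 1 of every file): the venture produces certified bounds
on lattice expectations at stated coupling, gauge group, dimension and torus size; NOT a mass gap,
NOT a continuum limit, NOT a string tension; NOT Yang–Mills-summit-bearing (barriers
`FixedCouplingUltralocality`, `PerturbativeInvisibility`). This module is a POSITIVE structural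
result about which positivity constraints a two-dimensional TORUS certificate may use at which
couplings; it discharges nothing else and no certificate of the cell sits at `β < 0`.

★★★ **`DiagRPTwo.gaugeInvariantDiagonalRP_two_even_allGroups`**: on `(ℤ/L)²`, `L ≥ 4` even, for
EVERY compact metrisable group `G`, EVERY continuous finite-dimensional representation `ρ` and
EVERY real `β`, closed-half diagonal reflection positivity holds for gauge-invariant observables:
`GaugeInvariantDiagonalRP ρ β i j`. This closes the last open cell of the two-dimensional
gauge-invariant table (`DiagonalRPTorusTwoGaugeInvariantTable.lean` needed `ρ(z) = -1` for a
central involution `z`, i.e. `SU(2n)`, `U(N)`; `SU(2n+1)`, `SO(3)`, exceptional and finite groups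
were open at `β < 0`), improves L3(ε) (`L ≥ 6`, `β ≥ 0`) to `L ≥ 4`, and gives the `SU(N)` table for
every `N ≥ 2` (`gaugeInvariantDiagonalRP_two_iff_suN`, `diagonalRP_two_table_suN`): FULL closed-half
diagonal RP `↔ (Odd L ∧ 0 ≤ β) ∨ β = 0`, GAUGE-INVARIANT `↔ Even L ∨ 0 ≤ β`; and for a general
`ρ` with scalar commutant and `ρ ≢ 1`: gauge-invariant RP `↔ Even L ∨ 0 ≤ β`
(`gaugeInvariantDiagonalRP_two_iff_even_or_nonneg`); `L = 2` is excluded for cause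
(`DiagonalRPTorusGaugeInvariantFour.gaugeInvariantDiagonalRP_two_iff`: for `β ≥ 0` the gauge-invariant
statement holds iff `4 ≤ L`).

## Mechanism (new; character-free)

Parts I–IV (`DiagonalRPTorusEvenHalfGauge`, `…BackLayer`, `…CycleAverage`, `…Kernels`): averaging the
half-gauge group at the two cut layers replaces the cut weight by
`A_{w^{⋆L}}(stairC L U, stairD L U) · A_{w^{⋆L}}(stairDc L U, stairCc L U)`, `A_u(C, D) = ∫ u(xCx⁻¹D⁻¹)dx`,
`w = e^{β Re tr ρ}`. Here: for EVEN `L = 2(m+1)`, `w^{⋆L} = u ⋆ u` with `u = w^{⋆(m+1)}`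
(`ClassConv.conv_cpow_cpow`), so `A_{w^{⋆L}}(C, D) = ∫ A_u(C, k) A_u(D, k) dk`
(`ClassConv.twoSided_conv`, `twoSided_symm`) — a positive-semidefinite kernel WHATEVER THE SIGN of
`β`; since `stairD L U = stairC L (ΘU)` and `stairCc L U` is conjugate to `stairDc L (ΘU)` (the swap
is the half-turn of the back layer, `twoSided_stairCc_eq`), the RP pairing becomes
`∫∫ dk dk' |∫ g(U) A_u(stairC L U, k) A_u(stairDc L U, k') dU|² ≥ 0` (`integral_rpPhi_nonneg_all`;
independence of the two closed halves under product Haar measure, `L ≥ 4` even). In characters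
this is Migdal's `Σ_{λ,μ} ŵ_λ^L ŵ_μ^L |…|²`; the proof uses no character theory (no Peter–Weyl).
The parity of `L` is exactly what separates the even tori from the odd ones, where the same
pairing evaluates to `c_β^L · (positive)` with `c_β < 0` for `β < 0`
(`DiagonalRPTorusOddGaugeInvariantNegative.lean`).

NOT claimed: anything at `β < 0` in `d ≥ 3` (there closed-half diagonal RP fails gauge-invariantly
at every `β`, `DiagonalRPTorusGaugeInvariantNegative.lean`); `L = 2`; the FULL (gauge-variant)
statement, false for `β ≠ 0` (`DiagonalRPTorusTwoAllBeta.lean`).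

References: A. A. Migdal, Sov. Phys. JETP 42 (1975) 413; J.-M. Drouffe, J.-B. Zuber, Phys. Rep.
102 (1983) 1, §3; K. Osterwalder, E. Seiler, Ann. Phys. 110 (1978) 440, §2; E. Seiler, LNP 159
(1982) Ch. 2; V. Kazakov, Z. Zheng, arXiv:2203.11360 §3.1. The statement is, as far as searched
(corpus + galaxy), not in print.
-/

open MeasureTheory Complex Finset Function
open scoped ComplexOrder ENNReal

namespace Summit.QuantumFields.GaugeBoot

open Literature.MathematicalPhysics.QuantumFieldTheory
open Literature.RepresentationTheory.CompactGroups

noncomputable section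

namespace DiagRPTwo

/-! ## Positivity -/

section Positivity

variable {L N : ℕ} [NeZero L] {G : Type*} [Group G] [TopologicalSpace G] [IsTopologicalGroup G]
  [CompactSpace G] [MeasurableSpace G] [BorelSpace G] [SecondCountableTopology G]
  (ρ : G →* Matrix (Fin N) (Fin N) ℂ)

/-- **The Gram step**: for continuous real closed-half factors `a, b`,
`∫ g conj(g∘Θ) · a (a∘Θ) · b (b∘Θ) dU = |∫ g a b dU|²` (independence of the two closed halves
under product Haar measure, `L ≥ 4` even). -/
theorem integral_gg_mul_eq_normSq (hL : Even L) (h4 : 4 ≤ L) {i j : Fin 2} (hij : i ≠ j)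
    (hρ : Continuous ρ) (β : ℝ) {F : GaugeConfig 2 L G → ℂ} (hF : Measurable F)
    (hFH : IsDiagonalHalfObservable i j F) {a b : GaugeConfig 2 L G → ℝ} (ha : Continuous a)
    (hb : Continuous b) (had : DependsOn a (halfLinks (L := L) i j : Set (Edge 2 L)))
    (hbd : DependsOn b (halfLinks (L := L) i j : Set (Edge 2 L))) :
    ∫ U, gg ρ i j β F U * ((a U * a (configDiagSwap i j U) * (b U * b (configDiagSwap i j U)) : ℝ) : ℂ)
        ∂(linkMeasure L G) =
      (Complex.normSq (∫ U, gObs ρ i j β F U * ((a U * b U : ℝ) : ℂ) ∂(linkMeasure L G)) : ℂ) := by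
  set Ψ : GaugeConfig 2 L G → ℂ := fun U => gObs ρ i j β F U * ((a U * b U : ℝ) : ℂ) with hΨ
  have hΘm : Measurable (configDiagSwap (G := G) (L := L) i j) :=
    measurable_pi_lambda _ fun e => measurable_pi_apply _
  have hΨm : Measurable Ψ :=
    (measurable_gObs ρ i j hρ β hF).mul (Complex.measurable_ofReal.comp (ha.mul hb).measurable)
  have hΨd : DependsOn Ψ (halfLinks (L := L) i j : Set (Edge 2 L)) := fun U V hUV => by
    simp only [hΨ, dependsOn_gObs ρ h4 hij β hFH hUV, had hUV, hbd hUV]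
  have hpt : ∀ U, gg ρ i j β F U *
      ((a U * a (configDiagSwap i j U) * (b U * b (configDiagSwap i j U)) : ℝ) : ℂ) =
      (starRingEnd ℂ) (Ψ (configDiagSwap i j U)) * Ψ U := fun U => by
    simp only [hΨ, gg, map_mul, Complex.conj_ofReal]
    push_cast
    ring
  simp_rw [hpt]
  have h1 : ∫ U, (starRingEnd ℂ) (Ψ (configDiagSwap i j U)) * Ψ U ∂(linkMeasure L G) =
      (∫ U, (starRingEnd ℂ) (Ψ (configDiagSwap i j U)) ∂(linkMeasure L G)) *
        ∫ U, Ψ U ∂(linkMeasure L G) :=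
    LatticeRP.integral_mul_eq_of_dependsOn (haarProbability G) _ _ (disjoint_halfLinks_image hL h4 hij)
      (Complex.continuous_conj.measurable.comp (hΨm.comp hΘm)) hΨm
      (fun U V hUV => congrArg (starRingEnd ℂ) (dependsOn_comp_configDiagSwap hΨd hUV)) hΨd
  rw [h1, integral_conj, integral_comp_configDiagSwap, Complex.normSq_eq_conj_mul_self]

/-- ★★ **`0 ≤ ∫ g conj(g∘Θ) E dU` at EVERY real `β`** for gauge-invariant closed-half observables
on `(ℤ/L)²`, `L ≥ 4` even, compact metrisable `G`. -/
theorem integral_rpPhi_nonneg_all (hL : Even L) (h4 : 4 ≤ L) {i j : Fin 2} (hij : i ≠ j)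
    (hρ : Continuous ρ) (β : ℝ) {F : GaugeConfig 2 L G → ℂ} (hF : Measurable F)
    {CF : ℝ} (hFb : ∀ U, ‖F U‖ ≤ CF) (hFH : IsDiagonalHalfObservable i j F) (hFg : IsGaugeInvariant F) :
    0 ≤ ∫ U, rpPhi ρ i j β F U ∂(linkMeasure L G) := by
  rw [integral_rpPhi_eq_kernels ρ hL h4 hij hρ β hF hFb hFH hFg]
  -- notation
  set u : G → ℝ := halfPow ρ β L with hu
  set A : GaugeConfig 2 L G → G → ℝ := fun U k => ClassConv.twoSided u (stairC i j L U) k with hA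
  set B : GaugeConfig 2 L G → G → ℝ := fun U k => ClassConv.twoSided u (stairDc i j L U) k with hB
  set Φ : GaugeConfig 2 L G → G × G → ℝ := fun U p =>
    A U p.1 * A (configDiagSwap i j U) p.1 * (B U p.2 * B (configDiagSwap i j U) p.2) with hΦ
  have huc : Continuous u := continuous_halfPow hρ
  have hΘc : Continuous (configDiagSwap (G := G) (L := L) i j) :=
    continuous_pi fun e => continuous_apply _
  -- (1) the kernels as one integral over `G × G`
  have hK : ∀ U : GaugeConfig 2 L G, mirK ρ i j β U * backK ρ i j β U =
      ∫ p, Φ U p ∂((haarProbability G).prod (haarProbability G)) := by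
    intro U
    rw [mirK_eq_integral hL h4 hρ, backK_eq_integral hL h4 hij hρ,
      ← integral_prod_mul (μ := haarProbability G) (ν := haarProbability G)]
  simp_rw [hK]
  -- (2) joint integrability on `U × (k, k')`
  obtain ⟨Bu, hBu⟩ := isCompact_univ.exists_bound_of_continuousOn huc.continuousOn
  have hBu' : ∀ k, |u k| ≤ Bu := fun k => by rw [← Real.norm_eq_abs]; exact hBu k (Set.mem_univ _)
  have hAb : ∀ U k, |A U k| ≤ Bu := fun U k => ClassConv.abs_twoSided_le hBu' _ _
  have hBb : ∀ U k, |B U k| ≤ Bu := fun U k => ClassConv.abs_twoSided_le hBu' _ _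
  have hBu0 : 0 ≤ Bu := (abs_nonneg _).trans (hAb (fun _ => 1) 1)
  have hΦb : ∀ U p, |Φ U p| ≤ Bu ^ 4 := fun U p => by
    simp only [hΦ, abs_mul]
    have e4 : Bu ^ 4 = Bu * Bu * (Bu * Bu) := by ring
    rw [e4]
    exact mul_le_mul (mul_le_mul (hAb _ _) (hAb _ _) (abs_nonneg _) hBu0)
      (mul_le_mul (hBb _ _) (hBb _ _) (abs_nonneg _) hBu0) (by positivity) (by positivity)
  have hΦc : Continuous (Function.uncurry Φ) := by
    have hT := ClassConv.continuous_twoSided huc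
    have hA2 : Continuous fun q : GaugeConfig 2 L G × (G × G) => A q.1 q.2.1 :=
      hT.comp (((continuous_stairC L).comp continuous_fst).prodMk (continuous_fst.comp continuous_snd))
    have hA2' : Continuous fun q : GaugeConfig 2 L G × (G × G) => A (configDiagSwap i j q.1) q.2.1 :=
      hT.comp (((continuous_stairC L).comp (hΘc.comp continuous_fst)).prodMk
        (continuous_fst.comp continuous_snd))
    have hB2 : Continuous fun q : GaugeConfig 2 L G × (G × G) => B q.1 q.2.2 :=
      hT.comp (((continuous_stairDc L).comp continuous_fst).prodMk (continuous_snd.comp continuous_snd))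
    have hB2' : Continuous fun q : GaugeConfig 2 L G × (G × G) => B (configDiagSwap i j q.1) q.2.2 :=
      hT.comp (((continuous_stairDc L).comp (hΘc.comp continuous_fst)).prodMk
        (continuous_snd.comp continuous_snd))
    exact (hA2.mul hA2').mul (hB2.mul hB2')
  have hK2 : ∀ U, ‖gg ρ i j β F U‖ ≤ (CF * Real.exp (|β| * ((Sp (L := L) i j).card * N))) ^ 2 :=
    norm_gg_le ρ i j hρ β hFb
  have hint : Integrable (Function.uncurry fun (U : GaugeConfig 2 L G) (p : G × G) =>
      gg ρ i j β F U * (Φ U p : ℂ)) ((linkMeasure L G).prod ((haarProbability G).prod (haarProbability G))) := by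
    refine Integrable.of_bound (C := (CF * Real.exp (|β| * ((Sp (L := L) i j).card * N))) ^ 2 * Bu ^ 4)
      ?_ (ae_of_all _ fun q => ?_)
    · exact (((measurable_gg ρ i j hρ β hF).comp measurable_fst).mul
        (Complex.measurable_ofReal.comp hΦc.measurable)).aestronglyMeasurable
    · rw [Function.uncurry_apply_pair, norm_mul, Complex.norm_real, Real.norm_eq_abs]
      exact mul_le_mul (hK2 _) (hΦb _ _) (abs_nonneg _) ((norm_nonneg _).trans (hK2 q.1))
  -- (3) swap the integrals and evaluate the inner one as a square
  have h1 : ∀ U : GaugeConfig 2 L G, gg ρ i j β F U *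
      ((∫ p, Φ U p ∂((haarProbability G).prod (haarProbability G)) : ℝ) : ℂ) =
      ∫ p, gg ρ i j β F U * (Φ U p : ℂ) ∂((haarProbability G).prod (haarProbability G)) := fun U => by
    rw [← integral_complex_ofReal, integral_const_mul]
  simp_rw [h1]
  rw [integral_integral_swap hint]
  have hAd : ∀ k, DependsOn (fun U => A U k) (halfLinks (L := L) i j : Set (Edge 2 L)) :=
    fun k U V hUV => by simp only [hA, stairC_congr h4 hij hUV]
  have hBd : ∀ k, DependsOn (fun U => B U k) (halfLinks (L := L) i j : Set (Edge 2 L)) :=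
    fun k U V hUV => by simp only [hB, stairDc_congr h4 hij hUV]
  have hAc : ∀ k, Continuous fun U => A U k := fun k =>
    (ClassConv.continuous_twoSided huc).comp ((continuous_stairC L).prodMk continuous_const)
  have hBc : ∀ k, Continuous fun U => B U k := fun k =>
    (ClassConv.continuous_twoSided huc).comp ((continuous_stairDc L).prodMk continuous_const)
  have h2 : ∀ p : G × G, ∫ U, gg ρ i j β F U * (Φ U p : ℂ) ∂(linkMeasure L G) =
      (Complex.normSq (∫ U, gObs ρ i j β F U * ((A U p.1 * B U p.2 : ℝ) : ℂ) ∂(linkMeasure L G)) : ℂ) :=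
    fun p => integral_gg_mul_eq_normSq ρ hL h4 hij hρ β hF hFH (hAc p.1) (hBc p.2) (hAd p.1) (hBd p.2)
  simp_rw [h2]
  rw [integral_complex_ofReal]
  exact Complex.zero_le_real.2 (integral_nonneg fun p => Complex.normSq_nonneg _)

/-- ★★★ **Diagonal reflection positivity HOLDS on the two-dimensional even torus for gauge-invariant
observables, at EVERY coupling and for EVERY compact gauge group.** Let `L ≥ 4` be even, `G` a
compact metrisable group, `ρ` a continuous finite-dimensional representation, `β ∈ ℝ` arbitrary,
`i ≠ j`. Then for every bounded measurable GAUGE-INVARIANT observable `F` of the closed diagonal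
half `{0 ≤ (y_i - y_j) mod L ≤ L/2}`, `0 ≤ ⟨(ΘF)‾ F⟩_{Λ,β}` (real and non-negative). -/
theorem wilsonExpectation_swap_nonneg_of_isGaugeInvariant_all (hL : Even L) (h4 : 4 ≤ L)
    (hρ : Continuous ρ) (β : ℝ) {i j : Fin 2} (hij : i ≠ j)
    {F : GaugeConfig 2 L G → ℂ} (hF : Measurable F) (hFb : ∃ C : ℝ, ∀ U, ‖F U‖ ≤ C)
    (hFH : IsDiagonalHalfObservable i j F) (hFg : IsGaugeInvariant F) :
    0 ≤ wilsonExpectation ρ β fun U => (starRingEnd ℂ) (F (configDiagSwap i j U)) * F U := by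
  obtain ⟨CF, hFb⟩ := hFb
  have hdens : Measurable fun U : GaugeConfig 2 L G =>
      ENNReal.ofReal (Real.exp (-β * wilsonAction ρ U)) :=
    ENNReal.measurable_ofReal.comp ((WilsonRP.measurable_wilsonAction ρ hρ).const_mul (-β)).exp
  unfold wilsonExpectation wilsonMeasure
  rw [integral_smul_measure]
  unfold wilsonWeight
  rw [integral_withDensity_eq_integral_toReal_smul hdens (ae_of_all _ fun _ => ENNReal.ofReal_lt_top)]
  simp_rw [ENNReal.toReal_ofReal (Real.exp_nonneg _), Complex.real_smul]
  refine mul_nonneg (Complex.zero_le_real.2 ENNReal.toReal_nonneg) ?_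
  simp_rw [rpIntegrand_eq ρ hL h4 hij hρ β F]
  rw [integral_const_mul]
  exact mul_nonneg (Complex.zero_le_real.2 (Real.exp_pos _).le)
    (integral_rpPhi_nonneg_all ρ hL h4 hij hρ β hF hFb hFH hFg)

/-- ★★★ **Packaged: `GaugeInvariantDiagonalRP ρ β i j` on `(ℤ/L)²`, `L ≥ 4` even, for EVERY real
`β`, EVERY compact metrisable `G` and EVERY continuous `ρ`.** Supersedes L3(ε)
(`gaugeInvariantDiagonalRP_two`: `L ≥ 6`, `β ≥ 0`) and `gaugeInvariantDiagonalRP_two_even_allBeta`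
(`ρ(z) = -1` for a central involution `z`). -/
theorem gaugeInvariantDiagonalRP_two_even_allGroups (hL : Even L) (h4 : 4 ≤ L) (hρ : Continuous ρ)
    (β : ℝ) {i j : Fin 2} (hij : i ≠ j) : GaugeInvariantDiagonalRP (d := 2) (L := L) ρ β i j :=
  fun _ hF hFb hFH hFg =>
    wilsonExpectation_swap_nonneg_of_isGaugeInvariant_all ρ hL h4 hρ β hij hF hFb hFH hFg

/-- ★★★ **The two-torus gauge-invariant table for a general representation**: on `(ℤ/L)²`,
`L ≥ 4`, for a continuous `ρ` with scalar commutant and `ρ ≢ 1` (e.g. every `SU(N)`, `U(N)`,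
`SO(3)`), and every real `β`: `GaugeInvariantDiagonalRP ρ β i j ↔ Even L ∨ 0 ≤ β`. -/
theorem gaugeInvariantDiagonalRP_two_iff_even_or_nonneg [T2Space G] (h4 : 4 ≤ L) (hρ : Continuous ρ)
    (hirr : TwistedSlab.HasScalarCommutant ρ) (hρ1 : ∃ g, ρ g ≠ 1) {i j : Fin 2} (hij : i ≠ j)
    (β : ℝ) : GaugeInvariantDiagonalRP (d := 2) (L := L) ρ β i j ↔ (Even L ∨ 0 ≤ β) := by
  rcases Nat.even_or_odd L with hE | hO
  · exact ⟨fun _ => Or.inl hE, fun _ => gaugeInvariantDiagonalRP_two_even_allGroups ρ hE h4 hρ β hij⟩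
  · have h5 : 5 ≤ L := by obtain ⟨r, hr⟩ := hO; omega
    rw [gaugeInvariantDiagonalRP_odd_iff ρ hO h5 hij hρ hirr hρ1 β]
    exact ⟨Or.inr, fun h => h.resolve_left fun hE => (Nat.not_even_iff_odd.2 hO) hE⟩

end Positivity

/-! ## `SU(N)` for every `N ≥ 2` -/

section SUN

open Literature.MathematicalPhysics.QuantumLattice

/-- ★★★ **`SU(N)`, every `N ≥ 1`, on the even torus `(ℤ/L)²`, `L ≥ 4`, every real `β`**: the
gauge-invariant closed-half diagonal RP holds (new for odd `N`, e.g. `SU(3)` at `β < 0`). -/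
theorem gaugeInvariantDiagonalRP_two_even_allBeta_suN {L N : ℕ} [NeZero L] (hL : Even L)
    (h4 : 4 ≤ L) {i j : Fin 2} (hij : i ≠ j) (β : ℝ) :
    GaugeInvariantDiagonalRP (d := 2) (L := L) (fundamentalRep (Fin N)) β i j := by
  haveI : SecondCountableTopology (Matrix (Fin N) (Fin N) ℂ) :=
    inferInstanceAs (SecondCountableTopology (Fin N → Fin N → ℂ))
  haveI : SecondCountableTopology (Matrix.specialUnitaryGroup (Fin N) ℂ) :=
    Topology.IsEmbedding.subtypeVal.secondCountableTopology
  exact gaugeInvariantDiagonalRP_two_even_allGroups (fundamentalRep (Fin N)) hL h4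
    (continuous_fundamentalRep (Fin N)) β hij

/-- ★★★ **`SU(N)`, every `N ≥ 2`, on `(ℤ/L)²` with `L ≥ 4`**: the gauge-invariant closed-half
diagonal RP holds iff `L` is even or `0 ≤ β` (the `SU(2n)` statement
`gaugeInvariantDiagonalRP_two_iff_su2n` without the parity hypothesis on `N`). -/
theorem gaugeInvariantDiagonalRP_two_iff_suN {L N : ℕ} [NeZero L] (h4 : 4 ≤ L) (hN : 2 ≤ N)
    {i j : Fin 2} (hij : i ≠ j) (β : ℝ) :
    GaugeInvariantDiagonalRP (d := 2) (L := L) (fundamentalRep (Fin N)) β i j ↔ (Even L ∨ 0 ≤ β) := by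
  rcases Nat.even_or_odd L with hE | hO
  · exact ⟨fun _ => Or.inl hE, fun _ => gaugeInvariantDiagonalRP_two_even_allBeta_suN hE h4 hij β⟩
  · have h5 : 5 ≤ L := by obtain ⟨r, hr⟩ := hO; omega
    rw [gaugeInvariantDiagonalRP_odd_iff_suN hO h5 hN hij β]
    exact ⟨Or.inr, fun h => h.resolve_left fun hE => (Nat.not_even_iff_odd.2 hO) hE⟩

/-- ★★★ **The `SU(N)` torus table, every `N ≥ 2`** (`(ℤ/L)²`, `L ≥ 4`, every real `β`): the FULL
closed-half diagonal RP holds iff `(Odd L ∧ 0 ≤ β) ∨ β = 0`, the GAUGE-INVARIANT one iff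
`Even L ∨ 0 ≤ β`. In particular for `SU(3)` on even tori at `β < 0` the diagonal obstruction is a
pure gauge artefact, exactly as for `SU(2)`. -/
theorem diagonalRP_two_table_suN {L N : ℕ} [NeZero L] (h4 : 4 ≤ L) (hN : 2 ≤ N) {i j : Fin 2}
    (hij : i ≠ j) (β : ℝ) :
    (DiagonalReflectionPositive (d := 2) (L := L) (fundamentalRep (Fin N)) β i j ↔
        (Odd L ∧ 0 ≤ β) ∨ β = 0) ∧
      (GaugeInvariantDiagonalRP (d := 2) (L := L) (fundamentalRep (Fin N)) β i j ↔
        (Even L ∨ 0 ≤ β)) :=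
  ⟨diagonalReflectionPositive_two_iff_suN hN (by omega) β hij,
    gaugeInvariantDiagonalRP_two_iff_suN h4 hN hij β⟩

/-- **Even torus, `β ≠ 0`, every `SU(N)` with `N ≥ 2`: a pure gauge artefact** — the full
closed-half diagonal RP fails while the gauge-invariant one holds. -/
theorem even_torus_gauge_artefact_suN {L N : ℕ} [NeZero L] (hL : Even L) (h4 : 4 ≤ L) (hN : 2 ≤ N)
    {i j : Fin 2} (hij : i ≠ j) {β : ℝ} (hβ : β ≠ 0) :
    ¬ DiagonalReflectionPositive (d := 2) (L := L) (fundamentalRep (Fin N)) β i j ∧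
      GaugeInvariantDiagonalRP (d := 2) (L := L) (fundamentalRep (Fin N)) β i j := by
  refine ⟨fun h => ?_, gaugeInvariantDiagonalRP_two_even_allBeta_suN hL h4 hij β⟩
  rcases (diagonalReflectionPositive_two_iff_suN hN (by omega) β hij).1 h with ⟨hO, -⟩ | h0
  · exact (Nat.not_odd_iff_even.2 hL) hO
  · exact hβ h0

end SUN

end DiagRPTwo

end

end Summit.QuantumFields.GaugeBoot
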